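import Mathlib
import Literature.NumberTheory.LFunctions.Zhang2022.Section4LineOneMellin
import Literature.NumberTheory.LFunctions.Zhang2022.Section4Lemma44Chain
import HarnessLib

/-!
# Zhang (2022) §4, Lemma 4.4: the line `Re w = 1` — the head and tail bounds "by (4.2) and
# (4.3)" behind "`= F(s,ψ) + Σ_{D⁴<n<P²} ν(n)ψ(n)n^{−s}g(P^{9/5}/n) + O(ε)`"

Topic `Literature/NumberTheory/LFunctions/Zhang2022` (Landau–Siegel adjudication tree;
verdict-neutral). Y. Zhang, *Discrete mean estimates and the Landau–Siegel zero*,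
arXiv:2211.02515v1 (2022) [Zhang2022LandauSiegel] — **an unrefereed manuscript under adjudication**
— §4, proof of Lemma 4.4, p. 19 (tex L1053–L1061; DAG `Z22:§4.u026`–`u027`):

> By (4.2) and (4.3),
> `(2πi)⁻¹∫_{(1)} L(s+w,ψ)L(s+w,ψχ)P^{(9/5)w} ω₁(w)dw/w = F(s,ψ) + Σ_{D⁴<n<P²} ν(n)ψ(n)n^{−s}g(P^{9/5}/n) + O(ε)`
> where `ε = exp{−c𝓛¹⁰}`.

The campaign's statements file types this as the node `Section4.LineOneEval`
(`Section4Statements.lean`, L1-t3): `∃ c > 0, ∃ C, ForAllLarge: ∀ ψ ∈ Ψ, ∀ s ∈ Ω₃,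
‖perronLine(LL(s+·), 1) − (F(s,ψ) + gSum(s))‖ ≤ C·e^{−c𝓛¹⁰}`. This file proves the two
size bounds that feed it (theorems only; no definition, no new named fact; the assembly
`Section4.lineOneEval_holds` is the sibling file `Section4LineOneEval.lean`), for the split
`n ≤ D⁴` / `D⁴ < n < ⌈P²⌉` / `n ≥ ⌈P²⌉` of the exact Mellin series of `Section4LineOneMellin`:

* head (`n ≤ D⁴`, "by (4.2)"): `|g(P^{9/5}/n) − 1| ≤ ½e^{−𝓛³⁰log²(P^{9/5}/n)} ≤ ½e^{−𝓛⁴⁸}`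
  (`log(P^{9/5}/D⁴) ≥ 𝓛⁹`), `|ν(n)ψ(n)n^{−s}| ≤ d(n) ≤ D⁴`, so the head differs from `F(s,ψ)` by at most
  `½D⁸e^{−𝓛⁴⁸} ≤ ½e^{−𝓛¹⁰}` (`Section4.norm_headError_le`);
* middle: verbatim the typed `Section4.gSum`;
* tail (`n ≥ ⌈P²⌉`, "by (4.3)"): `g(P^{9/5}/n) ≤ ½e^{−𝓛³⁰(log n − 9𝓛⁹/5)²} ≤ ½n^{−3}e^{−𝓛⁴⁸/50}`, so the
  tail is at most `(π²/12)e^{−𝓛⁴⁸/50} ≤ e^{−𝓛¹⁰}` (`Section4.norm_tailTerm_le`, `Section4.norm_tail_le`).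

Nothing about Theorems 1–2 of the source or about Landau–Siegel zeros is stated or implied.

## References

* Y. Zhang, arXiv:2211.02515v1 (2022), §4 p. 19 (proof of Lemma 4.4), (4.2), (4.3) p. 18.
  [cite: Zhang2022LandauSiegel, §4 Lemma 4.4 (proof) p. 19]
-/

noncomputable section

open Complex Real MeasureTheory Finset
open scoped LSeries.notation

namespace Literature.NumberTheory.LFunctions.Zhang2022.Section4

open Skeleton
open LSeries (term term_of_ne_zero term_zero)
open GaussWeight (gWeight gWeight_pos gWeight_lt_one abs_gWeight_sub_one_le gWeight_le)

section WithCharacter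

variable {D : ℕ} [NeZero D] (χ : DirichletCharacter ℂ D) (x : Chr D)

/-! ### The summand of the Mellin series -/

omit [NeZero D] in
/-- `|ν(n)ψ(n)| ≤ d(n) ≤ n`. [cite: Zhang2022LandauSiegel, §3 (3.1)] -/
theorem norm_nu_mul_psi_le (n : ℕ) : ‖nu χ n * x.ψ (n : ZMod x.p)‖ ≤ n := by
  rw [norm_mul]
  calc ‖nu χ n‖ * ‖x.ψ (n : ZMod x.p)‖ ≤ (n.divisors.card : ℝ) * 1 :=
        mul_le_mul (Literature.NumberTheory.LFunctions.norm_divisorSumChar_le χ n)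
          (DirichletCharacter.norm_le_one _ _) (norm_nonneg _) (Nat.cast_nonneg _)
    _ ≤ n := by rw [mul_one]; exact_mod_cast Nat.card_divisors_le_self n

omit [NeZero D] in
/-- For `n ≥ 1`: the `n`-th Mellin term is `ν(n)ψ(n)n^{−s}`.
[cite: Zhang2022LandauSiegel, §4 Lemma 4.4 (proof) p. 19] -/
theorem term_nu_psi_eq {n : ℕ} (hn : n ≠ 0) (s : ℂ) :
    term (fun n => nu χ n * x.ψ (n : ZMod x.p)) s n
      = nu χ n * x.ψ (n : ZMod x.p) * (n : ℂ) ^ (-s) := by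
  rw [term_of_ne_zero hn, div_eq_mul_inv, Complex.cpow_neg]

omit [NeZero D] in
/-- `|ν(n)ψ(n)n^{−s}| ≤ n` for `n ≥ 1` and `Re s ≥ 0`. [cite: Zhang2022LandauSiegel, §4 Lemma 4.4 (proof) p. 19] -/
theorem norm_term_nu_psi_le {n : ℕ} (hn : n ≠ 0) {s : ℂ} (hs : 0 ≤ s.re) :
    ‖nu χ n * x.ψ (n : ZMod x.p) * (n : ℂ) ^ (-s)‖ ≤ n := by
  have hn1 : (1 : ℝ) ≤ n := by exact_mod_cast Nat.one_le_iff_ne_zero.mpr hn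
  rw [norm_mul, Complex.norm_natCast_cpow_of_pos (Nat.pos_of_ne_zero hn), Complex.neg_re]
  calc ‖nu χ n * x.ψ (n : ZMod x.p)‖ * (n : ℝ) ^ (-s.re) ≤ n * 1 :=
        mul_le_mul (norm_nu_mul_psi_le χ x n)
          (Real.rpow_le_one_of_one_le_of_nonpos hn1 (by linarith)) (Real.rpow_nonneg (by linarith) _)
          (Nat.cast_nonneg _)
    _ = n := mul_one _

end WithCharacter

/-! ### Numerical bookkeeping (`𝓛 ≥ 2`) -/

/-- `log(P^{9/5}/D⁴) = (9/5)𝓛⁹ − 4𝓛 ≥ 𝓛⁹` for `𝓛 ≥ 2`. [cite: Zhang2022LandauSiegel, §2 (2.6)] -/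
theorem ell_pow_nine_le_log_X_div {D : ℕ} (hℓ2 : 2 ≤ ell D) :
    ell D ^ 9 ≤ Real.log (bigP D ^ (9 / 5 : ℝ) / (D : ℝ) ^ 4) := by
  have hℓ : 0 < ell D := by linarith
  have hDne : D ≠ 0 := by
    rintro rfl
    simp [ell] at hℓ2; linarith
  have hD0 : (0 : ℝ) < D := by exact_mod_cast Nat.pos_of_ne_zero hDne
  have hP : 0 < bigP D := Real.exp_pos _
  rw [Real.log_div (Real.rpow_pos_of_pos hP _).ne' (by positivity), Real.log_rpow hP, bigP,
    Real.log_exp, Real.log_pow, ← ell]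
  have h8 : (2 : ℝ) ^ 8 ≤ ell D ^ 8 := pow_le_pow_left₀ (by norm_num) hℓ2 8
  push_cast
  nlinarith [h8, hℓ.le, show ell D ^ 9 = ell D * ell D ^ 8 by ring]

/-- `8𝓛 − 𝓛⁴⁸ ≤ −𝓛¹⁰` for `𝓛 ≥ 2`. [cite: Zhang2022LandauSiegel, §4 Lemma 4.4 (proof) p. 19] -/
theorem head_exponent_le {Lr : ℝ} (hL : 2 ≤ Lr) : 8 * Lr - Lr ^ 48 ≤ -Lr ^ 10 := by
  have hL0 : 0 ≤ Lr := by linarith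
  have h9 : (2 : ℝ) ^ 9 ≤ Lr ^ 9 := pow_le_pow_left₀ (by norm_num) hL 9
  have h38 : (2 : ℝ) ≤ Lr ^ 38 := le_trans hL (le_self_pow₀ (by linarith) (by norm_num))
  have hL10 : 0 ≤ Lr ^ 10 := pow_nonneg hL0 10
  have h48 : 2 * Lr ^ 10 ≤ Lr ^ 48 := by
    calc 2 * Lr ^ 10 = Lr ^ 10 * 2 := by ring
      _ ≤ Lr ^ 10 * Lr ^ 38 := mul_le_mul_of_nonneg_left h38 hL10
      _ = Lr ^ 48 := by ring
  have h10 : 16 * Lr ≤ Lr ^ 10 := by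
    calc 16 * Lr ≤ 2 ^ 9 * Lr := by nlinarith
      _ ≤ Lr ^ 9 * Lr := mul_le_mul_of_nonneg_right h9 hL0
      _ = Lr ^ 10 := by ring
  linarith

/-- The tail exponent: for `𝓛 ≥ 2` and `u ≥ 2𝓛⁹`, `𝓛³⁰((9/5)𝓛⁹ − u)² ≥ 3u + 𝓛⁴⁸/50`.
[cite: Zhang2022LandauSiegel, §4 Lemma 4.4 (proof) p. 19] -/
theorem tail_exponent_le {Lr u : ℝ} (hL : 2 ≤ Lr) (hu : 2 * Lr ^ 9 ≤ u) :
    3 * u + Lr ^ 48 / 50 ≤ Lr ^ 30 * ((9 / 5 : ℝ) * Lr ^ 9 - u) ^ 2 := by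
  have hL0 : 0 ≤ Lr := by linarith
  have h9 : (2 : ℝ) ^ 9 ≤ Lr ^ 9 := pow_le_pow_left₀ (by norm_num) hL 9
  have h39 : (2 : ℝ) ^ 39 ≤ Lr ^ 39 := pow_le_pow_left₀ (by norm_num) hL 39
  set d : ℝ := u - (9 / 5 : ℝ) * Lr ^ 9 with hd
  have hd1 : Lr ^ 9 / 5 ≤ d := by rw [hd]; linarith
  have hd2 : u / 10 ≤ d := by rw [hd]; linarith
  have hL9 : 0 ≤ Lr ^ 9 := pow_nonneg hL0 9
  have hu0 : 0 ≤ u := le_trans (by linarith) hu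
  have hd0 : 0 ≤ d := le_trans (by linarith) hd1
  have hsq : (Lr ^ 9 / 5) * (u / 10) ≤ d ^ 2 := by
    rw [sq]; exact mul_le_mul hd1 hd2 (by linarith) hd0
  have e : ((9 / 5 : ℝ) * Lr ^ 9 - u) ^ 2 = d ^ 2 := by rw [hd]; ring
  rw [e]
  have h1 : Lr ^ 30 * ((Lr ^ 9 / 5) * (u / 10)) ≤ Lr ^ 30 * d ^ 2 :=
    mul_le_mul_of_nonneg_left hsq (pow_nonneg hL0 30)
  have h2 : Lr ^ 30 * ((Lr ^ 9 / 5) * (u / 10)) = Lr ^ 39 * u / 50 := by ring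
  -- `L³⁹u/50 ≥ 3u + L⁴⁸/50` since `u ≥ 2L⁹` and `L³⁹ ≥ 2³⁹`
  have h3 : 3 * u + Lr ^ 48 / 50 ≤ Lr ^ 39 * u / 50 := by
    have e48 : Lr ^ 48 = Lr ^ 39 * Lr ^ 9 := by ring
    rw [e48]
    nlinarith [mul_le_mul_of_nonneg_left hu (pow_nonneg hL0 39),
      mul_le_mul_of_nonneg_right h39 hu0]
  linarith

/-- `𝓛⁴⁸/50 ≥ 𝓛¹⁰` for `𝓛 ≥ 2`. [cite: Zhang2022LandauSiegel, §4 Lemma 4.4 (proof) p. 19] -/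
theorem pow_ten_le_pow_48_div {Lr : ℝ} (hL : 2 ≤ Lr) : Lr ^ 10 ≤ Lr ^ 48 / 50 := by
  have hL0 : 0 ≤ Lr := by linarith
  have h38 : (2 : ℝ) ^ 38 ≤ Lr ^ 38 := pow_le_pow_left₀ (by norm_num) hL 38
  have e : Lr ^ 48 = Lr ^ 10 * Lr ^ 38 := by ring
  rw [e]
  nlinarith [pow_nonneg hL0 10, mul_le_mul_of_nonneg_left h38 (pow_nonneg hL0 10)]

/-- `D⁴ + 1 ≤ P²` for `𝓛 ≥ 2`. [cite: Zhang2022LandauSiegel, §2 (2.6)] -/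
theorem pow_four_add_one_le_bigP_sq {D : ℕ} (hℓ2 : 2 ≤ ell D) :
    (D : ℝ) ^ 4 + 1 ≤ bigP D ^ 2 := by
  have hℓ : 0 < ell D := by linarith
  have hDne : D ≠ 0 := by
    rintro rfl
    simp [ell] at hℓ2; linarith
  have hD0 : (0 : ℝ) < D := by exact_mod_cast Nat.pos_of_ne_zero hDne
  have hD1 : (1 : ℝ) ≤ (D : ℝ) ^ 4 := one_le_pow₀ (by exact_mod_cast Nat.one_le_iff_ne_zero.mpr hDne)
  have hD' : (D : ℝ) ^ 4 = Real.exp (4 * ell D) := by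
    rw [ell, show (4 : ℝ) * Real.log D = Real.log ((D : ℝ) ^ 4) by
      rw [Real.log_pow]; norm_num, Real.exp_log (by positivity)]
  have h8 : (2 : ℝ) ^ 8 ≤ ell D ^ 8 := pow_le_pow_left₀ (by norm_num) hℓ2 8
  have hexp : 4 * ell D + 1 ≤ (2 : ℕ) * ell D ^ 9 := by
    push_cast
    calc 4 * ell D + 1 ≤ 2 * (ell D * ell D ^ 8) := by nlinarith [h8, hℓ.le]
      _ = 2 * ell D ^ 9 := by ring
  have h1 : Real.exp (4 * ell D + 1) ≤ bigP D ^ 2 := by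
    rw [bigP, ← Real.exp_nat_mul]
    exact Real.exp_le_exp.mpr hexp
  have h2 : (D : ℝ) ^ 4 + 1 ≤ Real.exp (4 * ell D + 1) := by
    rw [Real.exp_add, ← hD']
    have he : (2 : ℝ) ≤ Real.exp 1 := by
      have := Real.add_one_le_exp (1 : ℝ); linarith
    nlinarith
  exact h2.trans h1

section WithCharacter

variable {D : ℕ} [NeZero D] (χ : DirichletCharacter ℂ D) (x : Chr D)

/-! ### Head: `n ≤ D⁴`, by (4.2) -/

/-- **Head error, "by (4.2)"**: for `𝓛 ≥ 2`, `Re s ≥ 0`: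
`|Σ_{n≤D⁴} ν(n)ψ(n)n^{−s}(g(P^{9/5}/n) − 1)| ≤ ½e^{−𝓛¹⁰}`. [cite: Zhang2022LandauSiegel, §4 Lemma 4.4 (proof) p. 19] -/
theorem norm_headError_le (hℓ2 : 2 ≤ ell D) {s : ℂ} (hs : 0 ≤ s.re) :
    ‖∑ n ∈ Finset.Icc 1 (D ^ 4), nu χ n * x.ψ (n : ZMod x.p) * (n : ℂ) ^ (-s)
        * ((gW D (bigP D ^ (9 / 5 : ℝ) / (n : ℝ)) : ℂ) - 1)‖
      ≤ (1 / 2) * Real.exp (-(ell D ^ 10)) := by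
  have hℓ : 0 < ell D := by linarith
  have hDne : D ≠ 0 := by
    rintro rfl
    simp [ell] at hℓ2; linarith
  have hD0 : (0 : ℝ) < D := by exact_mod_cast Nat.pos_of_ne_zero hDne
  have hP : 0 < bigP D := Real.exp_pos _
  have hX : 0 < bigP D ^ (9 / 5 : ℝ) := Real.rpow_pos_of_pos hP _
  have hΛ : 0 < ell D ^ 30 := by positivity
  have hlogX := ell_pow_nine_le_log_X_div hℓ2
  -- termwise bound `≤ D⁴ · ½ e^{−𝓛⁴⁸}`
  have hterm : ∀ n ∈ Finset.Icc 1 (D ^ 4),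
      ‖nu χ n * x.ψ (n : ZMod x.p) * (n : ℂ) ^ (-s)
          * ((gW D (bigP D ^ (9 / 5 : ℝ) / (n : ℝ)) : ℂ) - 1)‖
        ≤ (D : ℝ) ^ 4 * ((1 / 2) * Real.exp (-(ell D ^ 48))) := by
    intro n hn
    obtain ⟨hn1, hn4⟩ := Finset.mem_Icc.mp hn
    have hn0 : n ≠ 0 := by omega
    have hnR : (0 : ℝ) < n := by exact_mod_cast hn1
    have hn4R : (n : ℝ) ≤ (D : ℝ) ^ 4 := by exact_mod_cast hn4
    -- `y = X/n ≥ X/D⁴`, `log y ≥ 𝓛⁹`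
    have hy : bigP D ^ (9 / 5 : ℝ) / (D : ℝ) ^ 4 ≤ bigP D ^ (9 / 5 : ℝ) / n :=
      div_le_div_of_nonneg_left hX.le hnR hn4R
    have hlogy : ell D ^ 9 ≤ Real.log (bigP D ^ (9 / 5 : ℝ) / n) :=
      hlogX.trans (Real.log_le_log (by positivity) hy)
    have hy1 : 1 ≤ bigP D ^ (9 / 5 : ℝ) / n := by
      have h9 : (0 : ℝ) < ell D ^ 9 := by positivity
      have : 0 < Real.log (bigP D ^ (9 / 5 : ℝ) / n) := lt_of_lt_of_le h9 hlogy
      exact (Real.log_pos_iff (by positivity)).mp this |>.le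
    have hg : |gW D (bigP D ^ (9 / 5 : ℝ) / n) - 1| ≤ (1 / 2) * Real.exp (-(ell D ^ 48)) := by
      rw [gW]
      refine (abs_gWeight_sub_one_le hΛ hy1).trans ?_
      gcongr
      have hsq : ell D ^ 18 ≤ Real.log (bigP D ^ (9 / 5 : ℝ) / n) ^ 2 := by
        calc ell D ^ 18 = (ell D ^ 9) ^ 2 := by ring
          _ ≤ _ := pow_le_pow_left₀ (by positivity) hlogy 2
      calc -(ell D ^ 30) * Real.log (bigP D ^ (9 / 5 : ℝ) / n) ^ 2
          ≤ -(ell D ^ 30) * ell D ^ 18 := by nlinarith [hΛ]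
        _ = -(ell D ^ 48) := by ring
    rw [norm_mul]
    have h1 : ‖nu χ n * x.ψ (n : ZMod x.p) * (n : ℂ) ^ (-s)‖ ≤ (D : ℝ) ^ 4 :=
      (norm_term_nu_psi_le χ x hn0 hs).trans hn4R
    have h2 : ‖(gW D (bigP D ^ (9 / 5 : ℝ) / (n : ℝ)) : ℂ) - 1‖
        ≤ (1 / 2) * Real.exp (-(ell D ^ 48)) := by
      rw [← Complex.ofReal_one, ← Complex.ofReal_sub, Complex.norm_real, Real.norm_eq_abs]
      exact hg
    exact mul_le_mul h1 h2 (norm_nonneg _) (by positivity)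
  calc _ ≤ ∑ n ∈ Finset.Icc 1 (D ^ 4), (D : ℝ) ^ 4 * ((1 / 2) * Real.exp (-(ell D ^ 48))) :=
        (norm_sum_le _ _).trans (Finset.sum_le_sum hterm)
    _ = (D : ℝ) ^ 4 * ((D : ℝ) ^ 4 * ((1 / 2) * Real.exp (-(ell D ^ 48)))) := by
        rw [Finset.sum_const, Nat.card_Icc, nsmul_eq_mul]; push_cast; ring
    _ = (1 / 2) * Real.exp (8 * ell D - ell D ^ 48) := by
        have hD8 : (D : ℝ) ^ 4 * (D : ℝ) ^ 4 = Real.exp (8 * ell D) := by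
          rw [ell, show (8 : ℝ) * Real.log D = Real.log ((D : ℝ) ^ 8) by
            rw [Real.log_pow]; norm_num, Real.exp_log (by positivity)]; ring
        rw [sub_eq_add_neg, Real.exp_add, ← hD8]; ring
    _ ≤ (1 / 2) * Real.exp (-(ell D ^ 10)) := by
        gcongr; exact head_exponent_le hℓ2

/-! ### Tail: `n ≥ P²`, by (4.3) -/

omit [NeZero D] in
/-- **Tail terms, "by (4.3)"**: for `𝓛 ≥ 2`, `Re s ≥ 0` and `m ≥ P²`:
`|ν(m)ψ(m)m^{−s}g(P^{9/5}/m)| ≤ ½e^{−𝓛⁴⁸/50}·m^{−2}`. [cite: Zhang2022LandauSiegel, §4 Lemma 4.4 (proof) p. 19] -/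
theorem norm_tailTerm_le (hℓ2 : 2 ≤ ell D) {s : ℂ} (hs : 0 ≤ s.re) {m : ℕ}
    (hm : bigP D ^ 2 ≤ (m : ℝ)) :
    ‖term (fun n => nu χ n * x.ψ (n : ZMod x.p)) s m * (gW D (bigP D ^ (9 / 5 : ℝ) / (m : ℝ)) : ℂ)‖
      ≤ (1 / 2) * Real.exp (-(ell D ^ 48 / 50)) / (m : ℝ) ^ 2 := by
  have hℓ : 0 < ell D := by linarith
  have hP : 0 < bigP D := Real.exp_pos _
  have hP1 : 1 ≤ bigP D := by rw [bigP]; exact Real.one_le_exp (by positivity)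
  have hX : 0 < bigP D ^ (9 / 5 : ℝ) := Real.rpow_pos_of_pos hP _
  have hΛ : 0 < ell D ^ 30 := by positivity
  have hm1 : (1 : ℝ) ≤ m := le_trans (one_le_pow₀ hP1) hm
  have hm0 : (0 : ℝ) < m := by linarith
  have hmne : m ≠ 0 := by
    rintro rfl; simp at hm0
  -- `y = X/m ≤ 1`
  have hy0 : 0 < bigP D ^ (9 / 5 : ℝ) / m := div_pos hX hm0
  have hy1 : bigP D ^ (9 / 5 : ℝ) / m ≤ 1 := by
    rw [div_le_one hm0]
    refine le_trans ?_ hm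
    calc bigP D ^ (9 / 5 : ℝ) ≤ bigP D ^ (2 : ℝ) :=
          Real.rpow_le_rpow_of_exponent_le hP1 (by norm_num)
      _ = bigP D ^ 2 := by norm_num
  -- `u = log m ≥ 2𝓛⁹`, `log y = (9/5)𝓛⁹ − u`
  set u : ℝ := Real.log m with hu
  have hu2 : 2 * ell D ^ 9 ≤ u := by
    have h := Real.log_le_log (by positivity) hm
    rw [bigP, ← Real.exp_nat_mul, Real.log_exp] at h
    rw [hu]; push_cast at h; linarith
  have hlogy : Real.log (bigP D ^ (9 / 5 : ℝ) / m) = (9 / 5 : ℝ) * ell D ^ 9 - u := by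
    rw [Real.log_div hX.ne' hm0.ne', Real.log_rpow hP, bigP, Real.log_exp]
  have hg : gW D (bigP D ^ (9 / 5 : ℝ) / m)
      ≤ (1 / 2) * Real.exp (-(3 * u + ell D ^ 48 / 50)) := by
    rw [gW]
    refine (gWeight_le hΛ hy0 hy1).trans ?_
    rw [hlogy]
    gcongr
    have := tail_exponent_le hℓ2 hu2
    linarith
  have hexp : Real.exp (-(3 * u + ell D ^ 48 / 50))
      = Real.exp (-(ell D ^ 48 / 50)) / (m : ℝ) ^ 3 := by
    rw [show -(3 * u + ell D ^ 48 / 50) = -(ell D ^ 48 / 50) - 3 * u by ring, Real.exp_sub,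
      hu, show (3 : ℝ) * Real.log m = Real.log ((m : ℝ) ^ 3) by rw [Real.log_pow]; norm_num,
      Real.exp_log (by positivity)]
  have hg0 : 0 ≤ gW D (bigP D ^ (9 / 5 : ℝ) / m) := (gWeight_pos hΛ _).le
  rw [norm_mul, term_nu_psi_eq χ x hmne, Complex.norm_real, Real.norm_eq_abs, abs_of_nonneg hg0]
  calc ‖nu χ m * x.ψ (m : ZMod x.p) * (m : ℂ) ^ (-s)‖ * gW D (bigP D ^ (9 / 5 : ℝ) / m)
      ≤ (m : ℝ) * ((1 / 2) * Real.exp (-(3 * u + ell D ^ 48 / 50))) :=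
        mul_le_mul (norm_term_nu_psi_le χ x hmne hs) hg hg0 hm0.le
    _ = (1 / 2) * Real.exp (-(ell D ^ 48 / 50)) / (m : ℝ) ^ 2 := by
        rw [hexp]; field_simp

omit [NeZero D] in
/-- **Tail, summed**: for `𝓛 ≥ 2`, `Re s ≥ 0` and `N ≥ P²` (`N ≥ 1`): the Mellin terms from `N` on are
summable and `|Σ'_{n} (term)(n+N)| ≤ e^{−𝓛¹⁰}` (`½·(π²/6)·e^{−𝓛⁴⁸/50} ≤ e^{−𝓛¹⁰}`).
[cite: Zhang2022LandauSiegel, §4 Lemma 4.4 (proof) p. 19] -/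
theorem norm_tail_le (hℓ2 : 2 ≤ ell D) {s : ℂ} (hs : 0 ≤ s.re) {N : ℕ} (hN : bigP D ^ 2 ≤ (N : ℝ)) :
    Summable (fun n : ℕ => term (fun n => nu χ n * x.ψ (n : ZMod x.p)) s (n + N)
        * (gW D (bigP D ^ (9 / 5 : ℝ) / ((n + N : ℕ) : ℝ)) : ℂ)) ∧
      ‖∑' n : ℕ, term (fun n => nu χ n * x.ψ (n : ZMod x.p)) s (n + N)
          * (gW D (bigP D ^ (9 / 5 : ℝ) / ((n + N : ℕ) : ℝ)) : ℂ)‖ ≤ Real.exp (-(ell D ^ 10)) := by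
  have hP : 0 < bigP D := Real.exp_pos _
  have hP1 : 1 ≤ bigP D := by rw [bigP]; exact Real.one_le_exp (by positivity)
  have hN1 : (1 : ℝ) ≤ N := le_trans (one_le_pow₀ hP1) hN
  set K : ℝ := (1 / 2) * Real.exp (-(ell D ^ 48 / 50)) with hK
  have hK0 : 0 ≤ K := by positivity
  -- the majorant `K/(n+N)²`
  set b : ℕ → ℝ := fun n => K / (((n + N : ℕ) : ℝ)) ^ 2 with hb
  have hζ : Summable (fun n : ℕ => (1 : ℝ) / (n : ℝ) ^ 2) := hasSum_zeta_two.summable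
  have hζN : Summable (fun n : ℕ => (1 : ℝ) / (((n + N : ℕ) : ℝ)) ^ 2) :=
    (summable_nat_add_iff N).mpr hζ
  have hbsum : Summable b := by
    have : b = fun n => K * ((1 : ℝ) / (((n + N : ℕ) : ℝ)) ^ 2) := by
      funext n; rw [hb]; ring
    rw [this]; exact hζN.mul_left K
  have hbound : ∀ n : ℕ, ‖term (fun n => nu χ n * x.ψ (n : ZMod x.p)) s (n + N)
      * (gW D (bigP D ^ (9 / 5 : ℝ) / ((n + N : ℕ) : ℝ)) : ℂ)‖ ≤ b n := by
    intro n
    have hm : bigP D ^ 2 ≤ ((n + N : ℕ) : ℝ) := le_trans hN (by exact_mod_cast Nat.le_add_left N n)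
    have h := norm_tailTerm_le χ x hℓ2 hs hm
    rw [hb]; exact h
  have hsum : Summable (fun n : ℕ => term (fun n => nu χ n * x.ψ (n : ZMod x.p)) s (n + N)
      * (gW D (bigP D ^ (9 / 5 : ℝ) / ((n + N : ℕ) : ℝ)) : ℂ)) :=
    Summable.of_norm_bounded hbsum hbound
  refine ⟨hsum, ?_⟩
  have hnorm : Summable (fun n : ℕ => ‖term (fun n => nu χ n * x.ψ (n : ZMod x.p)) s (n + N)
      * (gW D (bigP D ^ (9 / 5 : ℝ) / ((n + N : ℕ) : ℝ)) : ℂ)‖) :=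
    Summable.of_nonneg_of_le (fun n => norm_nonneg _) hbound hbsum
  -- `Σ' 1/(n+N)² ≤ π²/6`
  have htailζ : ∑' n : ℕ, (1 : ℝ) / (((n + N : ℕ) : ℝ)) ^ 2 ≤ Real.pi ^ 2 / 6 := by
    have h := hζ.sum_add_tsum_nat_add N
    rw [hasSum_zeta_two.tsum_eq] at h
    have hnonneg : 0 ≤ ∑ i ∈ Finset.range N, (1 : ℝ) / (i : ℝ) ^ 2 :=
      Finset.sum_nonneg fun i _ => by positivity
    linarith
  calc _ ≤ ∑' n : ℕ, ‖term (fun n => nu χ n * x.ψ (n : ZMod x.p)) s (n + N)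
          * (gW D (bigP D ^ (9 / 5 : ℝ) / ((n + N : ℕ) : ℝ)) : ℂ)‖ := norm_tsum_le_tsum_norm hnorm
    _ ≤ ∑' n : ℕ, b n := hnorm.tsum_le_tsum hbound hbsum
    _ = K * ∑' n : ℕ, (1 : ℝ) / (((n + N : ℕ) : ℝ)) ^ 2 := by
        rw [← tsum_mul_left]; congr 1; funext n; rw [hb]; ring
    _ ≤ K * (Real.pi ^ 2 / 6) := mul_le_mul_of_nonneg_left htailζ hK0
    _ ≤ Real.exp (-(ell D ^ 48 / 50)) * 1 := by
        rw [hK]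
        have hπ : Real.pi ^ 2 / 6 ≤ 2 := by nlinarith [Real.pi_lt_d2, Real.pi_pos]
        nlinarith [Real.exp_pos (-(ell D ^ 48 / 50))]
    _ ≤ Real.exp (-(ell D ^ 10)) := by
        rw [mul_one]; exact Real.exp_le_exp.mpr (by linarith [pow_ten_le_pow_48_div hℓ2])

end WithCharacter

end Literature.NumberTheory.LFunctions.Zhang2022.Section4

end
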